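import Mathlib

/-!
# `Balaban1983to89.B9Eq365QGGQLowerVariationalSharpFloor` — T. Bałaban, *Propagators for lattice gauge theories in a background field*, Commun. Math.
# Phys. **99** (1985) 389–434 [Balaban1985BackgroundPropagators] Thm 3.11 p. 416 with (3.16) p. 393, (3.35) p. 396, and [Balaban1984PropagatorsII]
# (2.74)–(2.77) p. 236: **THE PURE-REAL FLOOR OF THE PEDESTAL ROAD ON PRINT's DIAGONAL** — the two one-coordinate ratios of ne9-leaf-01's
# `B9Eq365QGGQLowerVariationalSharp` (`12N²∕(N²+2) ≤ 12`, `(3∕5)(2N⁴+5N²+8)∕(N²+2)² ≤ 6∕5`, every `N ≥ 1`; `private` there) as importable lemmas, the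
# pedestal's sup ratio `(N∕2 + N²∕4)^d ≤ (21∕10)^d((N²+2)∕6)^d`, and the diagonal floor `κ♯ ≥ 1∕(36Λ♯²)`, `Λ♯ = 24d(6∕5)^{d−1} + 1 + 9a′∕4` of the
# windowed sharp closed form (this seat's `B9Eq365QGGQLowerVariationalWindowTowerSharp.qggq_coercive_window_tower_sharp`) — numbers, no operators

statement-level skeleton of published theorems with citation tags; proofs where landed; nothing here is a claim about the Yang–Mills mass gap

CITATION HEADER (lean-in-tree rule).  Audit cell `pub-balaban`, sub-cell `t4`, BINDER row NE9; filed by NE9 crux-team LEAF PROVER 03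
(`b2b-balaban-t4-ne9-formalise-leaf-03`, gen 73).  Pure real arithmetic serving the operator files of the same seat (kept apart so that each stays under
the tree's 400-line bound and this one is Mathlib-only); the ratios are ne9-leaf-01 g79's (`B9Eq365QGGQLowerVariationalSharp` §2, located floats: true flat
constant `5.43·10⁻⁴ ∕ 4.21·10⁻⁴ ∕ 3.40·10⁻⁴` at `d = 4`, `L = 3 ∕ 4 ∕ 6`).  Sources READ: as the operator files ([B9] pp. 393–396, 416; [B6] p. 236).

WHAT IS PROVED (sorry-free; Mathlib only; [folklore] real arithmetic).
* **`energy_ratio_le`** — `N²·d·(N(N²+2)∕3)·(N(2N⁴+5N²+8)∕60)^{d−1}·N^{−d} ≤ 12d(6∕5)^{d−1}·(((N²+2)∕6)^d)²` for every real `N ≥ 1`.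
* **`sup_ratio_le`** — `(N∕2 + N²∕4)^d ≤ (21∕10)^d·((N²+2)∕6)^d` (`0 ≤ N`; per coordinate `0 ≤ 2(N²−5N+7)`).
* (private `add_sq_le_weighted`: `(a+b)² ≤ (1+t)a² + (1+t⁻¹)b²`); **`kappa_sharp_floor_param`** — with `β = ((N²+2)∕6)^d`, `B = (N∕2+N²∕4)^d`, readings `x = N`,
  `w = 1`, `v = N^{−d}`, scaled edge `x·e ≤ Kα`, loss parameters `0 ≤ θ < 1`, `t > 0`, windows `ρB ≤ θβ`, `dK²α²(441∕100)^d ≤ δ`: the parametrised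
  closed form `(((1−θ)β)²∕M)²·w∕(1+ρ)²`, `M = (1+t)x²(…)v + (1+t⁻¹)x²e²dB²w + a′(β+ρB)²`, is `≥ ((1−θ)²∕((1+t)·12d(6∕5)^{d−1} + (1+t⁻¹)δ + a′(1+θ)²))²∕(1+θ)²`
  — TENDING TO leaf-01's flat `(12d(6∕5)^{d−1} + a′)⁻² = 1.42·10⁻⁴` as `θ, t, δ → 0`; **`kappa_sharp_floor`** — the instance `θ = 1∕2`, `t = 1`,
  `δ = 1∕2` (numerals left as they instantiate): `≥ 1∕(36Λ♯²)`, `Λ♯ = 24d(6∕5)^{d−1} + 1 + 9a′∕4` (`9.7·10⁻⁷` at `d = 4`, `a′ = 1`).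
* **`window_of_ratio_sharp`** — `ρ ≤ (10∕21)^d∕2 ⟹ ρB ≤ β∕2`.
HONEST SCOPE.  Numbers only; NOT NE9 (cell pub-balaban: NE9 NOT PRINTED ∕ NOT PROVED; spine PROVED 0∕9; HONEST DEPENDENCY: continuum YM on T⁴ ⇐ BetaPertH ∧
nine spine estimates (0/9 proved); BetaPertH ⇐ (D1) ∧ (D4) ∧ CAP+tail; G-an2-4 gates asym, D1 and NE2/3/4).  NEW file; nothing modified.  Net new unproved facts: 0.
-/

noncomputable section

namespace Literature.MathematicalPhysics.QuantumFieldTheory.Balaban1983to89.B9Eq365QGGQLowerVariationalSharpFloor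

variable {d : ℕ}

/-- **THE PEDESTAL ENERGY RATIO AT `c = N∕2`, EVERY `N ≥ 1`**: `N²·d·(N(N²+2)∕3)·(N(2N⁴+5N²+8)∕60)^{d−1}·N^{−d} ≤ 12d(6∕5)^{d−1}·β♯²`,
`β♯ = ((N²+2)∕6)^d` — leaf-01's two one-coordinate ratios `12N²∕(N²+2) ≤ 12`, `(3∕5)(2N⁴+5N²+8)∕(N²+2)² ≤ 6∕5` (their `ratio_prod_le` is private; re-derived).
[folklore] [cite: Balaban1985BackgroundPropagators, Thm 3.11 p.416, (3.16) p.393] -/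
theorem energy_ratio_le {N : ℝ} (hN : 1 ≤ N) (d : ℕ) :
    N ^ 2 * ((d : ℝ) * (N * (N ^ 2 + 2) / 3) * (N * (2 * N ^ 4 + 5 * N ^ 2 + 8) / 60) ^ (d - 1)) * (N ^ d)⁻¹ ≤
      12 * (d : ℝ) * (6 / 5) ^ (d - 1) * (((N ^ 2 + 2) / 6) ^ d) ^ 2 := by
  have hN0 : 0 < N := by linarith
  rcases Nat.eq_zero_or_pos d with hd | hd
  · subst hd; simp
  obtain ⟨e, rfl⟩ : ∃ e, d = e + 1 := ⟨d - 1, (Nat.sub_add_cancel hd).symm⟩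
  rw [Nat.add_sub_cancel]
  -- per coordinate: `N(N²+2)∕3 · N² ≤ 12 · N · ((N²+2)∕6)²` and `N(2N⁴+5N²+8)∕60 ≤ (6∕5) · N · ((N²+2)∕6)²`
  have h1 : N * (N ^ 2 + 2) / 3 * N ^ 2 ≤ 12 * N * ((N ^ 2 + 2) / 6) ^ 2 := by nlinarith [sq_nonneg N, hN0]
  have h2 : N * (2 * N ^ 4 + 5 * N ^ 2 + 8) / 60 ≤ 6 / 5 * N * ((N ^ 2 + 2) / 6) ^ 2 := by nlinarith [sq_nonneg N, hN0]
  have h2' : (N * (2 * N ^ 4 + 5 * N ^ 2 + 8) / 60) ^ e ≤ (6 / 5 * N * ((N ^ 2 + 2) / 6) ^ 2) ^ e :=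
    pow_le_pow_left₀ (by positivity) h2 e
  have hY : (((N ^ 2 + 2) / 6) ^ (e + 1)) ^ 2 = (((N ^ 2 + 2) / 6) ^ 2) ^ (e + 1) := by rw [← pow_mul, mul_comm, pow_mul]
  rw [hY]
  set Y := ((N ^ 2 + 2) / 6) ^ 2 with hYdef
  have hNpow : (N ^ (e + 1))⁻¹ * N ^ (e + 1) = 1 := inv_mul_cancel₀ (by positivity)
  calc N ^ 2 * (((e + 1 : ℕ) : ℝ) * (N * (N ^ 2 + 2) / 3) * (N * (2 * N ^ 4 + 5 * N ^ 2 + 8) / 60) ^ e) * (N ^ (e + 1))⁻¹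
      = ((e + 1 : ℕ) : ℝ) * (N * (N ^ 2 + 2) / 3 * N ^ 2) * (N * (2 * N ^ 4 + 5 * N ^ 2 + 8) / 60) ^ e * (N ^ (e + 1))⁻¹ := by ring
    _ ≤ ((e + 1 : ℕ) : ℝ) * (12 * N * Y) * (6 / 5 * N * Y) ^ e * (N ^ (e + 1))⁻¹ := by gcongr
    _ = 12 * ((e + 1 : ℕ) : ℝ) * (6 / 5) ^ e * Y ^ (e + 1) * ((N ^ (e + 1))⁻¹ * N ^ (e + 1)) := by
        simp only [mul_pow, pow_succ]; ring
    _ = 12 * ((e + 1 : ℕ) : ℝ) * (6 / 5) ^ e * Y ^ (e + 1) := by rw [hNpow, mul_one]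

/-- **THE PEDESTAL's SUP RATIO**: `(N∕2 + N²∕4)^d ≤ (21∕10)^d·((N²+2)∕6)^d` (per coordinate `N∕2 + N²∕4 ≤ (7∕20)(N²+2)`, i.e. `0 ≤ 2(N²−5N+7)`).
[folklore] [cite: Balaban1985BackgroundPropagators, (3.16) p.393] -/
theorem sup_ratio_le {N : ℝ} (hN : 0 ≤ N) (d : ℕ) : (N / 2 + N ^ 2 / 4) ^ d ≤ (21 / 10 : ℝ) ^ d * ((N ^ 2 + 2) / 6) ^ d := by
  rw [← mul_pow]
  exact pow_le_pow_left₀ (by positivity) (by nlinarith [sq_nonneg (N - 5 / 2)]) d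

/-- `(a + b)² ≤ (1+t)a² + (1+t⁻¹)b²` for `t > 0` (`2ab ≤ ta² + b²∕t`; private — the same statement exists in a Summits file). [folklore] -/
private theorem add_sq_le_weighted {t : ℝ} (ht : 0 < t) (a b : ℝ) : (a + b) ^ 2 ≤ (1 + t) * a ^ 2 + (1 + t⁻¹) * b ^ 2 := by
  have h : 2 * a * b ≤ t * a ^ 2 + t⁻¹ * b ^ 2 := by
    have h1 : 0 ≤ (t * a - b) ^ 2 := sq_nonneg _
    have h2 : t⁻¹ * (t * a - b) ^ 2 = t * a ^ 2 - 2 * a * b + t⁻¹ * b ^ 2 := by field_simp; ring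
    nlinarith [mul_nonneg (inv_nonneg.2 ht.le) h1]
  nlinarith

/-- **THE DIAGONAL FLOOR OF THE SHARP CLOSED FORM, PARAMETRISED** (pure reals): with `β = ((N²+2)∕6)^d`, `B = (N∕2 + N²∕4)^d`, `1 ≤ N`, readings
`x = N` (`= |η⁻¹|`), `w = 1` (`= c₀N^d∕c₁`), `v = N^{−d}` (`= c₀∕c₁`), scaled edge `x·e ≤ Kα`, loss parameters `0 ≤ θ < 1`, `0 < t`, and the windows
`ρB ≤ θβ`, `dK²α²(441∕100)^d ≤ δ`: the parametrised closed form `(((1−θ)β)²∕M)²·w∕(1+ρ)²`, `M = (1+t)·E♯ + (1+t⁻¹)·E′ + a′(β+ρB)²`, is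
`≥ ((1−θ)²∕((1+t)·12d(6∕5)^{d−1} + (1+t⁻¹)δ + a′(1+θ)²))²∕(1+θ)²` — which tends to leaf-01's flat `(12d(6∕5)^{d−1} + a′)⁻²` as `θ, t, δ → 0`.
[folklore] [cite: Balaban1985BackgroundPropagators, Thm 3.11 p.416, (3.16) p.393, (3.35) p.396] -/
theorem kappa_sharp_floor_param {N x e w v K α a' ρ θ t δ : ℝ} (hN : 1 ≤ N) (ha' : 0 < a') (he0 : 0 ≤ e)
    (hx : x = N) (hw : w = 1) (hv : v = (N ^ d)⁻¹) (he : x * e ≤ K * α) (hρ0 : 0 ≤ ρ) (hθ0 : 0 ≤ θ) (hθ1 : θ < 1) (ht : 0 < t)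
    (hwin : ρ * (N / 2 + N ^ 2 / 4) ^ d ≤ θ * ((N ^ 2 + 2) / 6) ^ d) (hKα : (d : ℝ) * K ^ 2 * α ^ 2 * (441 / 100) ^ d ≤ δ) :
    ((1 - θ) ^ 2 / ((1 + t) * (12 * (d : ℝ) * (6 / 5) ^ (d - 1)) + (1 + t⁻¹) * δ + a' * (1 + θ) ^ 2)) ^ 2 / (1 + θ) ^ 2 ≤
      (((1 - θ) * ((N ^ 2 + 2) / 6) ^ d) ^ 2 /
          ((1 + t) * (x ^ 2 * ((d : ℝ) * (N * (N ^ 2 + 2) / 3) * (N * (2 * N ^ 4 + 5 * N ^ 2 + 8) / 60) ^ (d - 1)) * v) +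
            (1 + t⁻¹) * (x ^ 2 * e ^ 2 * (d : ℝ) * ((N / 2 + N ^ 2 / 4) ^ d) ^ 2 * w) +
            a' * (((N ^ 2 + 2) / 6) ^ d + ρ * (N / 2 + N ^ 2 / 4) ^ d) ^ 2)) ^ 2 * w / (1 + ρ) ^ 2 := by
  subst x
  rw [hw, hv]
  set β : ℝ := ((N ^ 2 + 2) / 6) ^ d with hβ
  set Bs : ℝ := (N / 2 + N ^ 2 / 4) ^ d with hBs
  set A : ℝ := 12 * (d : ℝ) * (6 / 5) ^ (d - 1) with hA
  set Λ : ℝ := (1 + t) * A + (1 + t⁻¹) * δ + a' * (1 + θ) ^ 2 with hΛ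
  set Mx : ℝ := (1 + t) * (N ^ 2 * ((d : ℝ) * (N * (N ^ 2 + 2) / 3) * (N * (2 * N ^ 4 + 5 * N ^ 2 + 8) / 60) ^ (d - 1)) * (N ^ d)⁻¹) +
    (1 + t⁻¹) * (N ^ 2 * e ^ 2 * (d : ℝ) * Bs ^ 2 * 1) + a' * (β + ρ * Bs) ^ 2 with hMx
  have hN0 : 0 < N := by linarith
  have hβ0 : 0 < β := by rw [hβ]; positivity
  have hBs0 : 0 < Bs := by rw [hBs]; positivity
  have hδ0 : 0 ≤ δ := le_trans (by positivity) hKα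
  have ht1 : 0 < 1 + t⁻¹ := by positivity
  have hΛ0 : 0 < Λ := by rw [hΛ, hA]; positivity
  have hMx0 : 0 < Mx := by rw [hMx]; positivity
  -- `β ≤ B ≤ (21∕10)^d β`, `ρ ≤ θ`
  have hβle : β ≤ Bs := by rw [hβ, hBs]; exact pow_le_pow_left₀ (by positivity) (by nlinarith) d
  have hBsle : Bs ≤ (21 / 10 : ℝ) ^ d * β := by rw [hBs, hβ]; exact sup_ratio_le hN0.le d
  have hρle : ρ ≤ θ := by
    have h1 : ρ * Bs ≤ θ * Bs := hwin.trans (mul_le_mul_of_nonneg_left hβle hθ0)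
    exact le_of_mul_le_mul_right h1 hBs0
  -- the `E♯`-term
  have hE : N ^ 2 * ((d : ℝ) * (N * (N ^ 2 + 2) / 3) * (N * (2 * N ^ 4 + 5 * N ^ 2 + 8) / 60) ^ (d - 1)) * (N ^ d)⁻¹ ≤ A * β ^ 2 := by
    rw [hβ, hA]; exact energy_ratio_le hN d
  -- the `E′♯`-term
  have hNe : (N * e) ^ 2 ≤ (K * α) ^ 2 := pow_le_pow_left₀ (by positivity) he 2
  have hBs2 : Bs ^ 2 ≤ (441 / 100 : ℝ) ^ d * β ^ 2 := by
    have h := pow_le_pow_left₀ hBs0.le hBsle 2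
    have e2 : ((21 / 10 : ℝ) ^ d) ^ 2 = (441 / 100) ^ d := by rw [← pow_mul, mul_comm, pow_mul]; norm_num
    rw [mul_pow, e2] at h
    exact h
  have hE' : N ^ 2 * e ^ 2 * (d : ℝ) * Bs ^ 2 ≤ δ * β ^ 2 := by
    rw [show N ^ 2 * e ^ 2 = (N * e) ^ 2 by ring]
    calc (N * e) ^ 2 * (d : ℝ) * Bs ^ 2 ≤ (K * α) ^ 2 * (d : ℝ) * ((441 / 100 : ℝ) ^ d * β ^ 2) := by gcongr
      _ = ((d : ℝ) * K ^ 2 * α ^ 2 * (441 / 100) ^ d) * β ^ 2 := by ring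
      _ ≤ δ * β ^ 2 := mul_le_mul_of_nonneg_right hKα (sq_nonneg _)
  -- the penalty term
  have hpen : (β + ρ * Bs) ^ 2 ≤ (1 + θ) ^ 2 * β ^ 2 := by
    have h1 : β + ρ * Bs ≤ (1 + θ) * β := by linarith [hwin]
    have h0 : 0 ≤ β + ρ * Bs := by positivity
    calc (β + ρ * Bs) ^ 2 ≤ ((1 + θ) * β) ^ 2 := pow_le_pow_left₀ h0 h1 2
      _ = (1 + θ) ^ 2 * β ^ 2 := by ring
  -- `M ≤ Λβ²`, `((1−θ)β)²∕M ≥ (1−θ)²∕Λ`, `(1+ρ)² ≤ (1+θ)²`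
  have hM : Mx ≤ Λ * β ^ 2 := by
    rw [hMx, hΛ, mul_one]
    linarith [mul_le_mul_of_nonneg_left hE (by positivity : (0:ℝ) ≤ 1 + t), mul_le_mul_of_nonneg_left hE' ht1.le,
      mul_le_mul_of_nonneg_left hpen ha'.le]
  have hk1 : (1 - θ) ^ 2 / Λ ≤ ((1 - θ) * β) ^ 2 / Mx := by
    rw [div_le_div_iff₀ hΛ0 hMx0]
    have := mul_le_mul_of_nonneg_left hM (sq_nonneg (1 - θ))
    linarith [this]
  have hk2 : ((1 - θ) ^ 2 / Λ) ^ 2 ≤ (((1 - θ) * β) ^ 2 / Mx) ^ 2 := pow_le_pow_left₀ (by positivity) hk1 2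
  have hρ2 : (1 + ρ) ^ 2 ≤ (1 + θ) ^ 2 := pow_le_pow_left₀ (by linarith) (by linarith) 2
  have hρ1 : 0 < (1 + ρ) ^ 2 := by positivity
  calc ((1 - θ) ^ 2 / Λ) ^ 2 / (1 + θ) ^ 2 ≤ (((1 - θ) * β) ^ 2 / Mx) ^ 2 / (1 + ρ) ^ 2 := div_le_div₀ (by positivity) hk2 hρ1 hρ2
    _ = (((1 - θ) * β) ^ 2 / Mx) ^ 2 * 1 / (1 + ρ) ^ 2 := by rw [mul_one]

/-- **THE DIAGONAL FLOOR, NUMERIC INSTANCE** (`θ = 1∕2`, `t = 1`, `δ = 1∕2`, the closed form as it instantiates — `(1 − 1∕2)`, `(1 + 1)`,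
`(1 + 1⁻¹)` left raw): `≥ 1∕(36Λ♯²)`, `Λ♯ = 24d(6∕5)^{d−1} + 1 + 9a′∕4` (`9.7·10⁻⁷` at `d = 4`, `a′ = 1`).
[folklore] [cite: Balaban1985BackgroundPropagators, Thm 3.11 p.416, (3.16) p.393, (3.35) p.396] -/
theorem kappa_sharp_floor {N x e w v K α a' ρ : ℝ} (hN : 1 ≤ N) (ha' : 0 < a') (he0 : 0 ≤ e)
    (hx : x = N) (hw : w = 1) (hv : v = (N ^ d)⁻¹) (he : x * e ≤ K * α) (hρ0 : 0 ≤ ρ)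
    (hwin : ρ * (N / 2 + N ^ 2 / 4) ^ d ≤ 1 / 2 * ((N ^ 2 + 2) / 6) ^ d) (hKα : (d : ℝ) * K ^ 2 * α ^ 2 * (441 / 100) ^ d ≤ 1 / 2) :
    1 / (36 * (24 * (d : ℝ) * (6 / 5) ^ (d - 1) + 1 + 9 * a' / 4) ^ 2) ≤
      (((1 - 1 / 2) * ((N ^ 2 + 2) / 6) ^ d) ^ 2 /
          ((1 + 1) * (x ^ 2 * ((d : ℝ) * (N * (N ^ 2 + 2) / 3) * (N * (2 * N ^ 4 + 5 * N ^ 2 + 8) / 60) ^ (d - 1)) * v) +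
            (1 + (1 : ℝ)⁻¹) * (x ^ 2 * e ^ 2 * (d : ℝ) * ((N / 2 + N ^ 2 / 4) ^ d) ^ 2 * w) +
            a' * (((N ^ 2 + 2) / 6) ^ d + ρ * (N / 2 + N ^ 2 / 4) ^ d) ^ 2)) ^ 2 * w / (1 + ρ) ^ 2 := by
  have h := kappa_sharp_floor_param (θ := 1 / 2) (t := 1) (δ := 1 / 2) hN ha' he0 hx hw hv he hρ0 (by norm_num) (by norm_num) one_pos
    hwin hKα
  have e1 : ((1 - 1 / 2 : ℝ) ^ 2 / ((1 + 1) * (12 * (d : ℝ) * (6 / 5) ^ (d - 1)) + (1 + (1 : ℝ)⁻¹) * (1 / 2) + a' * (1 + 1 / 2) ^ 2)) ^ 2 /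
      (1 + 1 / 2) ^ 2 = 1 / (36 * (24 * (d : ℝ) * (6 / 5) ^ (d - 1) + 1 + 9 * a' / 4) ^ 2) := by
    have hΛpos : 0 < 24 * (d : ℝ) * (6 / 5) ^ (d - 1) + 1 + 9 * a' / 4 := by positivity
    field_simp
    ring
  rw [e1] at h
  exact h

/-- `β♯∕B♯ ≥ (10∕21)^d`: the window letter `ρ ≤ (10∕21)^d∕2` implies the closed-form window `ρ·(N∕2 + N²∕4)^d ≤ ((N²+2)∕6)^d∕2` (`0 ≤ N`).
[folklore] [cite: Balaban1985BackgroundPropagators, (3.16) p.393] -/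
theorem window_of_ratio_sharp {N ρ : ℝ} (hN : 0 ≤ N) (d : ℕ) (hρ : ρ ≤ (10 / 21 : ℝ) ^ d / 2) :
    ρ * (N / 2 + N ^ 2 / 4) ^ d ≤ ((N ^ 2 + 2) / 6) ^ d / 2 := by
  have hB := sup_ratio_le hN d
  have hB0 : 0 ≤ (N / 2 + N ^ 2 / 4) ^ d := by positivity
  have h1 : (10 / 21 : ℝ) ^ d * (21 / 10 : ℝ) ^ d = 1 := by rw [← mul_pow]; norm_num
  calc ρ * (N / 2 + N ^ 2 / 4) ^ d ≤ (10 / 21 : ℝ) ^ d / 2 * ((21 / 10 : ℝ) ^ d * ((N ^ 2 + 2) / 6) ^ d) :=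
        (mul_le_mul_of_nonneg_right hρ hB0).trans (mul_le_mul_of_nonneg_left hB (by positivity))
    _ = ((10 / 21 : ℝ) ^ d * (21 / 10 : ℝ) ^ d) * ((N ^ 2 + 2) / 6) ^ d / 2 := by ring
    _ = ((N ^ 2 + 2) / 6) ^ d / 2 := by rw [h1, one_mul]


end Literature.MathematicalPhysics.QuantumFieldTheory.Balaban1983to89.B9Eq365QGGQLowerVariationalSharpFloor

end
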